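import Literature.Probability.Percolation.TriLowestCrossing
import HarnessLib

/-!
# Lowest crossings of a lattice domain: minimal terms met by crossings, pairs of disjoint crossings, the flipped domain

Topic: Probability / Percolation; family `crit-perc` (planar combinatorics of site percolation on
`𝕋`, in the abstract `JDomain` setting of `TriLowestCrossing.lean`). Serves the named fact
`Literature.Probability.Percolation.Werner2009_lemma63` (Werner 2009, Lecture 6, Lemma 6.3 for
the tree's ORDER-FREE `π̂_t`), whose last missing input is Nolin's arm-separation theorem
(EJP 13 (2008), Thm. 11 [arXiv 0711.4948: Thm. 10]) for four arms in the ADJACENT arrangement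
`σ = BBWW`, below `L(p)`. For that colour sequence two CONSECUTIVE arms have the same colour, and
the separation step (Nolin 2008, §4.4, proof of Lemma 15 [arXiv Lemma 14]: "any other set of
disjoint crossings can also be made well-separated … replace the tip of each `c'_v` by the tip of
one of the `c_u`'s … Consider then `c'_2`, and `c_{v_2}` the lowest crossing it intersects:
necessarily `v_2 > v_1`") must reroute two DISJOINT open crossings of the same U-shaped region
along two DISTINCT terms of the exploration sequence `c₀ < c₁ < ⋯` (`lowestSeq`), in the right
order. This file proves the order-theoretic facts behind that sentence, from Kesten's potential
argument (the lower envelope of a crossing and the lowest one has the potential of the lowest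
one):

* `above_subset_above_of_lowest` — **the lowest open crossing lies on or below every open
  crossing**: if `lowest ω = (c, z)` and `K` is an open crossing, then `above K ⊆ above c` and
  `c ⊆ lower K` (lower envelope `E` of `c` and `K`: `above c ∪ above K ⊆ above E`, and minimality
  of the potential of `c` forces `above E = above c`);
* `IsCrossing.ht_lt_of_mem_above` — a site of `J` above a crossing is higher than its tip;
* `subset_above_of_forall_disjoint` — an open crossing disjoint from the terms `c₀, …, c_n` lies
  above each of them (hence is open in the configuration explored at stage `n + 1`);
* `subset_lower_of_lowestSeq` — the same envelope statement at stage `u`: if `a` is an open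
  crossing above the terms before `u`, then `above a ⊆ above c_u` and `c_u ⊆ lower a`;
* `lowestSeq_subset_above_of_lt`, `ht_lowestSeq_lt_of_lt` — later terms lie above earlier ones
  and have higher tips;
* `pair_min_terms` — **Nolin's "`v₂ > v₁`"**: for two disjoint open crossings `a₁`, `a₂` with
  `a₁` below `a₂`, and `uᵢ` the least index of a term meeting `aᵢ`: `u₁ < u₂`, the upper crossing
  `a₂` is disjoint from `c_{u₁}` and lies above it (indeed above `a₁`), and `c_{uᵢ} ⊆ lower aᵢ`;
* `disjoint_of_stage_crossing_same_tip` — the obstruction lemma for rerouting: an open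
  crossing `K` with the tip `z_u` of the `u`-th term, lying above the earlier terms and disjoint
  from an open crossing `a` with a higher tip, forces `a ∩ c_u = ∅`;
* `lowestSeq_sdiff_lower` — **the sequence restarts above a term**: the exploration sequence of
  `ω ∖ lower c_u` is `c_{u+1}, c_{u+2}, …`;
* `JDomain.flip`, `flip_cutProp`, `flip_dualProp`, `flip_isCrossing_iff`, `flip_Jabove`,
  `flip_Jbelow` — **the flipped domain** (`Bt ↔ Tp`, height negated): the toolkit applied to it
  explores the HIGHEST crossings from above; both planar hypotheses are invariant.

Everything here is proved; no named facts are introduced.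

## References

* P. Nolin, Near-critical percolation in two dimensions, *Electron. J. Probab.* 13 (2008), §4.4,
  proof of Lemma 15 (arXiv 0711.4948: Lemma 14, last paragraph) [Nolin2008].
* H. Kesten, *Percolation theory for mathematicians*, Birkhäuser (1982), §2.3, Prop. 2.3 (the
  lowest occupied crosscut) [KestenPTM1982].
* H. Kesten, Scaling relations for 2D-percolation, *Comm. Math. Phys.* 109 (1987), Lemma 2
  [Kesten1987].

## Mathlib / tree

Tree: `JDomain`, `IsCrossing`, `above/below/lower`, `CutProp`, `DualProp`, `lowest`,
`lowest_eq_some_iff`, `mem_openCrossings`, `exists_crossing_envelope`,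
`above_subset_above_of_subset_envelope`, `not_subset_below_lowest`, `lowestSeq`,
`lowestSeq_succ_of_eq_some`, `exists_lowestSeq_eq_some_of_succ`, `isCrossing_of_lowestSeq`,
`lowestSeq_succ_subset_above`, `lower_subset_lower_of_le`, `lowestSeq_disjoint_of_lt`,
`IsCrossing.compare`, `IsCrossing.subset_above_or_disjoint`,
`IsCrossing.not_mem_above_of_mem_Bt_union`, `IsCrossing.mem_above_of_mem_Jabove`
(`TriLowestCrossing.lean`).
-/

noncomputable section

open Set

namespace Literature.Probability.Percolation

open LatticeModels

namespace JDomain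

variable {Q : JDomain}

/-! ### The lowest crossing lies on or below every open crossing -/

section Envelope

variable {ω : Set (Site 2)} {c K : Finset (Site 2)} {z w v : Site 2}

/-- **The lowest open crossing lies on or below every open crossing** (Kesten 1982, Prop. 2.3;
the potential argument of `lowest_congr`): if `lowest ω = (c, z)` and `K` is an open crossing
with tip `w`, then `above K ⊆ above c` and `c ⊆ lower K`. Proof: the lower envelope `E` of `c`
and `K` is an open crossing with `above c ∪ above K ⊆ above E`; its potential is at most that of
`c`, so by minimality they are equal and `above E = above c`. [cite: KestenPTM1982, §2.3 Prop. 2.3] -/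
theorem above_subset_above_of_lowest (hcut : Q.CutProp) (hdual : Q.DualProp)
    (h : Q.lowest ω = some (c, z)) (hK : Q.IsCrossing K w) (hKω : (↑K : Set (Site 2)) ⊆ ω) :
    Q.above K w ⊆ Q.above c z ∧ c ⊆ Q.lower K w := by
  obtain ⟨hp, hmin⟩ := lowest_eq_some_iff.1 h
  obtain ⟨hc, hcω⟩ := mem_openCrossings.1 hp
  dsimp only at hc hcω
  obtain ⟨E, wE, hE, hEsub⟩ := exists_crossing_envelope hcut hdual hc hK
  have hEA : Q.above c z ⊆ Q.above E wE := above_subset_above_of_subset_envelope hc hE hEsub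
  have hEA' : Q.above K w ⊆ Q.above E wE := by
    refine above_subset_above_of_subset_envelope (K' := c) (z' := z) hK hE ?_
    rwa [Finset.union_comm] at hEsub
  have hEω : (↑E : Set (Site 2)) ⊆ ω := by
    intro x hx
    rcases Finset.mem_union.1 (hEsub (Finset.mem_coe.1 hx)) with h1 | h1
    · exact hcω (Finset.mem_coe.2 (Finset.mem_sdiff.1 h1).1)
    · exact hKω (Finset.mem_coe.2 (Finset.mem_sdiff.1 h1).1)
  have hkeyE : Q.key (c, z) ≤ Q.key (E, wE) := hmin (E, wE) (mem_openCrossings.2 ⟨hE, hEω⟩)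
  have hpotE_c : Q.pot E wE ≤ Q.pot c z :=
    Finset.card_le_card (Finset.sdiff_subset_sdiff (Finset.Subset.refl _) hEA)
  have hpotc_E : Q.pot c z ≤ Q.pot E wE := by
    rw [key, key, Prod.Lex.le_iff] at hkeyE
    simp only [ofLex_toLex] at hkeyE
    omega
  have h1 : Q.pot E wE = Q.pot c z := le_antisymm hpotE_c hpotc_E
  have hAc : Q.above c z = Q.above E wE := by
    refine Finset.eq_of_subset_of_card_le hEA ?_
    have := Finset.card_sdiff_add_card_eq_card (above_subset_D (Q := Q) (c := c) (z := z))
    have := Finset.card_sdiff_add_card_eq_card (above_subset_D (Q := Q) (c := E) (z := wE))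
    unfold pot at h1
    omega
  have hKc : Q.above K w ⊆ Q.above c z := by rw [hAc]; exact hEA'
  refine ⟨hKc, fun x hx => ?_⟩
  have hxD : x ∈ Q.D := hc.subset hx
  exact (mem_lower_iff_not_mem_above hxD).2 fun hxa => not_mem_of_mem_above (hKc hxa) hx

end Envelope

/-! ### Heights of sites of `J` above a crossing -/

/-- **A site of the tip arc above a crossing is strictly higher than the tip** (under `CutProp`:
`J_{<z}` is not above, and the tip itself is on the crossing). [cite: KestenPTM1982, §2.3] -/
theorem IsCrossing.ht_lt_of_mem_above (hcut : Q.CutProp) {c : Finset (Site 2)} {z v : Site 2}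
    (hc : Q.IsCrossing c z) (hv : v ∈ Q.J) (hva : v ∈ Q.above c z) : Q.ht z < Q.ht v := by
  rcases lt_trichotomy (Q.ht z) (Q.ht v) with hh | hh | hh
  · exact hh
  · exfalso
    have := Q.ht_injOn (Finset.mem_coe.2 hc.tip_mem_J) (Finset.mem_coe.2 hv) hh
    exact not_mem_of_mem_above hva (this ▸ hc.tip_mem)
  · exact absurd hva (hc.not_mem_above_of_mem_Bt_union hcut
      (Finset.mem_union_right _ (mem_Jbelow.2 ⟨hv, hh⟩)))

/-- A connected set off a crossing which meets `above` lies inside `above`. [cite: KestenPTM1982, §2.3] -/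
theorem IsCrossing.subset_above_of_mem {c c' : Finset (Site 2)} {z v : Site 2} (hc : Q.IsCrossing c z)
    (hc'D : c' ⊆ Q.D) (hconn : ∀ u ∈ c', ∀ u' ∈ c', PathIn triGraph (↑c' : Set (Site 2)) u u')
    (hdisj : Disjoint c' c) (hv : v ∈ c') (hva : v ∈ Q.above c z) : c' ⊆ Q.above c z := by
  rcases hc.subset_above_or_disjoint hc'D hconn hdisj with hh | hh
  · exact hh
  · exact absurd hva (Finset.disjoint_left.1 hh hv)

/-! ### Crossings off the first terms lie above them -/

section Sequence

variable {ω : Set (Site 2)} {a c c' : Finset (Site 2)} {w z z' : Site 2}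

/-- **An open crossing disjoint from the terms `c₀, …, c_n` lies above `c_n`** (and above each of
them): below is excluded at every stage by minimality of the term in the configuration explored
at that stage (the induction of `exists_lowestSeq_inter_nonempty`). [cite: Nolin2008, §4.4 (arXiv 0711.4948: proof of Lemma 14, maximality)] -/
theorem subset_above_of_forall_disjoint (ha : Q.IsCrossing a w)
    (haω : (↑a : Set (Site 2)) ⊆ ω) :
    ∀ n, (∀ v ≤ n, ∀ c z, Q.lowestSeq ω v = some (c, z) → Disjoint a c) →
      ∀ c z, Q.lowestSeq ω n = some (c, z) → a ⊆ Q.above c z := by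
  intro n
  induction n with
  | zero =>
    intro hdis c z h
    have h0 : Q.lowest ω = some (c, z) := h
    have hc := (isCrossing_of_lowest h0).1
    have hd : Disjoint a c := hdis 0 le_rfl c z h
    rcases hc.subset_above_or_disjoint ha.subset ha.conn hd with hh | hh
    · exact hh
    · exfalso
      refine not_subset_below_lowest h0 ha haω fun v hv => mem_below.2 ⟨ha.subset hv, ?_, ?_⟩
      · exact Finset.disjoint_left.1 hd hv
      · exact Finset.disjoint_left.1 hh hv
  | succ n ih =>
    intro hdis c' z' h'
    obtain ⟨⟨c, z⟩, h⟩ := exists_lowestSeq_eq_some_of_succ h'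
    have hab : a ⊆ Q.above c z := ih (fun v hv => hdis v (Nat.le_succ_of_le hv)) c z h
    have haω' : (↑a : Set (Site 2)) ⊆ ω \ ↑(Q.lower c z) := by
      intro v hv
      refine ⟨haω hv, fun hvl => ?_⟩
      exact (mem_lower_iff_not_mem_above (ha.subset (Finset.mem_coe.1 hv))).1 (Finset.mem_coe.1 hvl)
        (hab (Finset.mem_coe.1 hv))
    have h'' : Q.lowest (ω \ ↑(Q.lower c z)) = some (c', z') := by
      rw [← lowestSeq_succ_of_eq_some h]; exact h'
    have hc' := (isCrossing_of_lowest h'').1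
    have hd : Disjoint a c' := hdis (n + 1) le_rfl c' z' h'
    rcases hc'.subset_above_or_disjoint ha.subset ha.conn hd with hh | hh
    · exact hh
    · exfalso
      refine not_subset_below_lowest h'' ha haω' fun v hv => mem_below.2 ⟨ha.subset hv, ?_, ?_⟩
      · exact Finset.disjoint_left.1 hd hv
      · exact Finset.disjoint_left.1 hh hv

/-- An open crossing above a term is open in the configuration explored after it. [cite: Nolin2008, §4.4 (arXiv 0711.4948: proof of Lemma 14)] -/
theorem subset_sdiff_lower_of_subset_above (ha : Q.IsCrossing a w) (haω : (↑a : Set (Site 2)) ⊆ ω)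
    (hab : a ⊆ Q.above c z) : (↑a : Set (Site 2)) ⊆ ω \ ↑(Q.lower c z) := by
  intro v hv
  refine ⟨haω hv, fun hvl => ?_⟩
  exact (mem_lower_iff_not_mem_above (ha.subset (Finset.mem_coe.1 hv))).1 (Finset.mem_coe.1 hvl)
    (hab (Finset.mem_coe.1 hv))

/-- **The `u`-th term lies on or below every open crossing above the earlier terms**: if
`lowestSeq ω u = (c, z)` and the open crossing `a` (tip `w`) lies above the term `u - 1` (no
condition for `u = 0`), then `above a ⊆ above c` and `c ⊆ lower a`. [cite: KestenPTM1982, §2.3 Prop. 2.3] [cite: Nolin2008, §4.4 (arXiv 0711.4948: proof of Lemma 14)] -/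
theorem subset_lower_of_lowestSeq (hcut : Q.CutProp) (hdual : Q.DualProp) {u : ℕ}
    (hu : Q.lowestSeq ω u = some (c, z)) (ha : Q.IsCrossing a w) (haω : (↑a : Set (Site 2)) ⊆ ω)
    (habove : ∀ v c' z', v + 1 = u → Q.lowestSeq ω v = some (c', z') → a ⊆ Q.above c' z') :
    Q.above a w ⊆ Q.above c z ∧ c ⊆ Q.lower a w := by
  cases u with
  | zero => exact above_subset_above_of_lowest hcut hdual hu ha haω
  | succ v =>
    obtain ⟨⟨c₀, z₀⟩, h₀⟩ := exists_lowestSeq_eq_some_of_succ hu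
    have hab : a ⊆ Q.above c₀ z₀ := habove v c₀ z₀ rfl h₀
    have haω' := subset_sdiff_lower_of_subset_above ha haω hab
    rw [lowestSeq_succ_of_eq_some h₀] at hu
    exact above_subset_above_of_lowest hcut hdual hu ha haω'

/-- **Later terms lie above earlier ones.** [cite: Nolin2008, §4.4 (arXiv 0711.4948: proof of Lemma 14)] -/
theorem lowestSeq_subset_above_of_lt (hcut : Q.CutProp) {u v : ℕ} (huv : u < v)
    (hu : Q.lowestSeq ω u = some (c, z)) (hv : Q.lowestSeq ω v = some (c', z')) :
    c' ⊆ Q.above c z := by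
  obtain ⟨k, rfl⟩ := Nat.exists_eq_add_of_lt huv
  obtain ⟨⟨c₁, z₁⟩, h₁⟩ := exists_lowestSeq_eq_some_of_succ hv
  have hlow : Q.lower c z ⊆ Q.lower c₁ z₁ := lower_subset_lower_of_le hcut (Nat.le_add_right u k) hu h₁
  have hab : c' ⊆ Q.above c₁ z₁ := (lowestSeq_succ_subset_above hcut h₁ hv).1
  intro x hx
  have hxD : x ∈ Q.D := (isCrossing_of_lowestSeq hv).1.subset hx
  by_contra hxa
  have hxl : x ∈ Q.lower c z := (mem_lower_iff_not_mem_above hxD).2 hxa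
  exact (mem_lower_iff_not_mem_above hxD).1 (hlow hxl) (hab hx)

/-- Later terms have strictly higher tips. [cite: Nolin2008, §4.4 (arXiv 0711.4948: proof of Lemma 14)] -/
theorem ht_lowestSeq_lt_of_lt (hcut : Q.CutProp) {u v : ℕ} (huv : u < v)
    (hu : Q.lowestSeq ω u = some (c, z)) (hv : Q.lowestSeq ω v = some (c', z')) :
    Q.ht z < Q.ht z' :=
  (isCrossing_of_lowestSeq hu).1.ht_lt_of_mem_above hcut (isCrossing_of_lowestSeq hv).1.tip_mem_J
    (lowestSeq_subset_above_of_lt hcut huv hu hv (isCrossing_of_lowestSeq hv).1.tip_mem)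

/-- **The sequence restarts above a term**: the exploration sequence of `ω ∖ lower c_u` is the
shifted sequence `c_{u+1}, c_{u+2}, …` (the regions on-or-below increase, so closing `lower c_u`
and then `lower c_{u+k}` is closing `lower c_{u+k}`). [cite: Nolin2008, §4.4 (arXiv 0711.4948: proof of Lemma 14)] -/
theorem lowestSeq_sdiff_lower (hcut : Q.CutProp) {u : ℕ} (hu : Q.lowestSeq ω u = some (c, z)) :
    ∀ k, Q.lowestSeq (ω \ ↑(Q.lower c z)) k = Q.lowestSeq ω (u + 1 + k) := by
  intro k
  induction k with
  | zero => rw [lowestSeq_zero, Nat.add_zero, lowestSeq_succ_of_eq_some hu]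
  | succ k ih =>
    rw [lowestSeq_succ, ih, show u + 1 + (k + 1) = (u + 1 + k) + 1 by ring, lowestSeq_succ]
    cases hk : Q.lowestSeq ω (u + 1 + k) with
    | none => rfl
    | some p =>
      obtain ⟨c₁, z₁⟩ := p
      have hlow : Q.lower c z ⊆ Q.lower c₁ z₁ := lower_subset_lower_of_le hcut (by omega) hu hk
      simp only
      congr 1
      ext v
      simp only [Set.mem_sdiff, Finset.mem_coe]
      constructor
      · rintro ⟨⟨h1, -⟩, h3⟩; exact ⟨h1, h3⟩
      · rintro ⟨h1, h3⟩; exact ⟨⟨h1, fun h2 => h3 (hlow h2)⟩, h3⟩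

end Sequence

/-! ### Two disjoint crossings: the minimal terms they meet -/

section Pair

variable {ω : Set (Site 2)} {a₁ a₂ c₁ c₂ : Finset (Site 2)} {w₁ w₂ z₁ z₂ : Site 2} {u₁ u₂ : ℕ}

/-- **Nolin's "`v₂ > v₁`" for two disjoint open crossings.** Let `a₁`, `a₂` be disjoint open
crossings with `ht w₁ < ht w₂` (so `a₂` lies above `a₁`), let `c_{u₁}` be a term with all
earlier terms disjoint from `a₁` (e.g. the first term meeting `a₁`; that it meets `a₁` is not
needed), and `c_{u₂}` a term meeting `a₂` with all earlier terms disjoint from `a₂`. Then: `a₂ ⊆ above a₁`;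
`c_{u₁} ⊆ lower a₁` and `above a₁ ⊆ above c_{u₁}` (so `a₂` is disjoint from `c_{u₁}` and lies
above it); `c_{u₂} ⊆ lower a₂`; and `u₁ < u₂`. [cite: Nolin2008, §4.4 (arXiv 0711.4948: proof of Lemma 14, "necessarily v₂ > v₁")] -/
theorem pair_min_terms (hcut : Q.CutProp) (hdual : Q.DualProp)
    (ha₁ : Q.IsCrossing a₁ w₁) (ha₁ω : (↑a₁ : Set (Site 2)) ⊆ ω)
    (ha₂ : Q.IsCrossing a₂ w₂) (ha₂ω : (↑a₂ : Set (Site 2)) ⊆ ω)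
    (hdisj : Disjoint a₁ a₂) (hlt : Q.ht w₁ < Q.ht w₂)
    (hu₁ : Q.lowestSeq ω u₁ = some (c₁, z₁))
    (hmin₁ : ∀ v < u₁, ∀ c z, Q.lowestSeq ω v = some (c, z) → Disjoint a₁ c)
    (hu₂ : Q.lowestSeq ω u₂ = some (c₂, z₂)) (hmeet₂ : (a₂ ∩ c₂).Nonempty)
    (hmin₂ : ∀ v < u₂, ∀ c z, Q.lowestSeq ω v = some (c, z) → Disjoint a₂ c) :
    a₂ ⊆ Q.above a₁ w₁ ∧ c₁ ⊆ Q.lower a₁ w₁ ∧ Q.above a₁ w₁ ⊆ Q.above c₁ z₁ ∧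
      Disjoint a₂ c₁ ∧ a₂ ⊆ Q.above c₁ z₁ ∧ c₂ ⊆ Q.lower a₂ w₂ ∧ u₁ < u₂ := by
  have h21 : a₂ ⊆ Q.above a₁ w₁ := (ha₁.compare hcut ha₂ hdisj hlt).1
  -- the earlier terms: `aᵢ` lies above them
  have hab₁ : ∀ v c z, v < u₁ → Q.lowestSeq ω v = some (c, z) → a₁ ⊆ Q.above c z :=
    fun v c z hv h => subset_above_of_forall_disjoint ha₁ ha₁ω v
      (fun v' hv' c' z' h' => hmin₁ v' (lt_of_le_of_lt hv' hv) c' z' h') c z h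
  have hab₂ : ∀ v c z, v < u₂ → Q.lowestSeq ω v = some (c, z) → a₂ ⊆ Q.above c z :=
    fun v c z hv h => subset_above_of_forall_disjoint ha₂ ha₂ω v
      (fun v' hv' c' z' h' => hmin₂ v' (lt_of_le_of_lt hv' hv) c' z' h') c z h
  obtain ⟨hA₁, hL₁⟩ := subset_lower_of_lowestSeq hcut hdual hu₁ ha₁ ha₁ω
    (fun v c z hv h => hab₁ v c z (by omega) h)
  obtain ⟨-, hL₂⟩ := subset_lower_of_lowestSeq hcut hdual hu₂ ha₂ ha₂ω
    (fun v c z hv h => hab₂ v c z (by omega) h)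
  have hc₁ := (isCrossing_of_lowestSeq hu₁).1
  have hc₂ := (isCrossing_of_lowestSeq hu₂).1
  -- `a₂` avoids `c₁`
  have hd21 : Disjoint a₂ c₁ := by
    refine Finset.disjoint_left.2 fun x hx₂ hx₁ => ?_
    have hxD : x ∈ Q.D := hc₁.subset hx₁
    exact (mem_lower_iff_not_mem_above hxD).1 (hL₁ hx₁) (h21 hx₂)
  have h2c₁ : a₂ ⊆ Q.above c₁ z₁ := h21.trans hA₁
  -- `u₁ < u₂`
  have hne : u₁ ≠ u₂ := by
    rintro rfl
    rw [hu₁] at hu₂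
    cases hu₂
    obtain ⟨x, hx⟩ := hmeet₂
    exact Finset.disjoint_left.1 hd21 (Finset.mem_inter.1 hx).1 (Finset.mem_inter.1 hx).2
  have hnlt : ¬ u₂ < u₁ := by
    intro h21'
    -- `a₁` lies above `c₂` and avoids it; `c₂` meets `a₂ ⊆ above a₁`, so `c₂ ⊆ above a₁`:
    -- then `z₂` is above `a₁` (higher than `w₁`) while `w₁` is above `c₂` (higher than `z₂`)
    have h1c₂ : a₁ ⊆ Q.above c₂ z₂ := hab₁ u₂ c₂ z₂ h21' hu₂
    have hd12 : Disjoint a₁ c₂ := hmin₁ u₂ h21' c₂ z₂ hu₂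
    obtain ⟨x, hx⟩ := hmeet₂
    have hx₂ : x ∈ a₂ := (Finset.mem_inter.1 hx).1
    have hxc : x ∈ c₂ := (Finset.mem_inter.1 hx).2
    have hc₂A : c₂ ⊆ Q.above a₁ w₁ :=
      ha₁.subset_above_of_mem hc₂.subset hc₂.conn hd12.symm hxc (h21 hx₂)
    have hz₂ : Q.ht w₁ < Q.ht z₂ := ha₁.ht_lt_of_mem_above hcut hc₂.tip_mem_J (hc₂A hc₂.tip_mem)
    have hw₁ : Q.ht z₂ < Q.ht w₁ := hc₂.ht_lt_of_mem_above hcut ha₁.tip_mem_J (h1c₂ ha₁.tip_mem)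
    exact lt_asymm hz₂ hw₁
  exact ⟨h21, hL₁, hA₁, hd21, h2c₁, hL₂, by omega⟩

/-- **The obstruction to rerouting through the tip of a term.** Let `c_u = lowestSeq ω u` have
tip `z`, let `K` be an open crossing with the SAME tip `z`, lying above the term `u - 1` (no
condition for `u = 0`), and let `a` be an open crossing disjoint from `K` with a higher tip. Then
`a` does not meet `c_u`: indeed `c_u ⊆ lower K` (`subset_lower_of_lowestSeq`) while `a ⊆ above K`
(comparability). In the rerouting of two same-colour arms this excludes that the final piece of
the upper arm's term, followed back from its tip, runs into the lower arm before the upper one. [cite: Nolin2008, §4.4 (arXiv 0711.4948: proof of Lemma 14, last paragraph)] -/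
theorem disjoint_of_stage_crossing_same_tip (hcut : Q.CutProp) (hdual : Q.DualProp) {u : ℕ}
    {c K a : Finset (Site 2)} {z w : Site 2}
    (hu : Q.lowestSeq ω u = some (c, z)) (hK : Q.IsCrossing K z) (hKω : (↑K : Set (Site 2)) ⊆ ω)
    (hKabove : ∀ v c' z', v + 1 = u → Q.lowestSeq ω v = some (c', z') → K ⊆ Q.above c' z')
    (ha : Q.IsCrossing a w) (hKa : Disjoint K a) (hlt : Q.ht z < Q.ht w) : Disjoint a c := by
  obtain ⟨-, hL⟩ := subset_lower_of_lowestSeq hcut hdual hu hK hKω hKabove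
  have haK : a ⊆ Q.above K z := (hK.compare hcut ha hKa hlt).1
  have hc := (isCrossing_of_lowestSeq hu).1
  refine Finset.disjoint_left.2 fun x hxa hxc => ?_
  exact (mem_lower_iff_not_mem_above (hc.subset hxc)).1 (hL hxc) (haK hxa)

end Pair

/-! ### The flipped domain: exploring from above -/

/-- **The flipped domain**: the same sites, tip arc and start set, with the reference arcs
exchanged (`Bt ↔ Tp`) and the height negated. Its lowest crossings are the HIGHEST crossings of
the original domain, its exploration sequence explores them from above. [cite: KestenPTM1982, §2.3 (highest/lowest crosscut)] -/
def flip (Q : JDomain) : JDomain where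
  D := Q.D
  J := Q.J
  F := Q.F
  Tp := Q.Bt
  Bt := Q.Tp
  ht := fun v => -Q.ht v
  J_subset := Q.J_subset
  F_subset := Q.F_subset
  Tp_subset := Q.Bt_subset
  Bt_subset := Q.Tp_subset
  ht_injOn := fun _ ha _ hb h => Q.ht_injOn ha hb (neg_inj.1 h)

/-- The flipped domain has the same sites. [folklore] -/
@[simp] theorem flip_D (Q : JDomain) : Q.flip.D = Q.D := rfl

/-- The flipped domain has the same tip arc. [folklore] -/
@[simp] theorem flip_J (Q : JDomain) : Q.flip.J = Q.J := rfl

/-- The flipped domain has the same start set. [folklore] -/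
@[simp] theorem flip_F (Q : JDomain) : Q.flip.F = Q.F := rfl

/-- The upper reference arc of the flipped domain is the lower one. [folklore] -/
@[simp] theorem flip_Tp (Q : JDomain) : Q.flip.Tp = Q.Bt := rfl

/-- The lower reference arc of the flipped domain is the upper one. [folklore] -/
@[simp] theorem flip_Bt (Q : JDomain) : Q.flip.Bt = Q.Tp := rfl

/-- The height of the flipped domain is the negated height. [folklore] -/
@[simp] theorem flip_ht (Q : JDomain) (v : Site 2) : Q.flip.ht v = -Q.ht v := rfl

/-- Crossings of the flipped domain are the crossings of the domain. [cite: KestenPTM1982, §2.3] -/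
theorem flip_isCrossing_iff (Q : JDomain) {c : Finset (Site 2)} {z : Site 2} :
    Q.flip.IsCrossing c z ↔ Q.IsCrossing c z :=
  ⟨fun h => ⟨h.subset, h.tip_mem, h.tip_mem_J, h.eq_tip, h.exists_start, h.conn⟩,
    fun h => ⟨h.subset, h.tip_mem, h.tip_mem_J, h.eq_tip, h.exists_start, h.conn⟩⟩

/-- `J_{>z}` of the flipped domain is `J_{<z}`. [cite: KestenPTM1982, §2.3] -/
@[simp] theorem flip_Jabove (Q : JDomain) (z : Site 2) : Q.flip.Jabove z = Q.Jbelow z := by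
  ext j; simp [Jabove, Jbelow, flip, neg_lt_neg_iff]

/-- `J_{<z}` of the flipped domain is `J_{>z}`. [cite: KestenPTM1982, §2.3] -/
@[simp] theorem flip_Jbelow (Q : JDomain) (z : Site 2) : Q.flip.Jbelow z = Q.Jabove z := by
  ext j; simp [Jabove, Jbelow, flip, neg_lt_neg_iff]

/-- **`CutProp` is invariant under flipping** (reverse the forbidden path). [cite: KestenPTM1982, §2.3] -/
theorem flip_cutProp {Q : JDomain} (h : Q.CutProp) : Q.flip.CutProp := by
  intro c z hc s hs e he hp
  rw [flip_Bt, flip_Jbelow] at hs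
  rw [flip_Tp, flip_Jabove] at he
  exact h ((flip_isCrossing_iff Q).1 hc) e he s hs (by simpa using hp.symm)

/-- **`DualProp` is invariant under flipping** (reverse the dual path). [cite: BollobasRiordan2006, Ch. 7 Lemma 5 p. 169] -/
theorem flip_dualProp {Q : JDomain} (h : Q.DualProp) : Q.flip.DualProp := by
  intro S hS
  rcases h S hS with h1 | ⟨s, hs, e, he, hp⟩
  · exact Or.inl h1
  · exact Or.inr ⟨e, he, s, hs, hp.symm⟩

end JDomain

end Literature.Probability.Percolation
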